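import Summits.NavierStokesRegularity.NavierStokesRegularity.Theorems.AxisTwistDoorAveragedConeLiouvilleNUDefs
import HarnessLib

/-!
# N4 / T1 piece W, brick (c2) tools: the one-slab form `nuSlabIneq` of `NUEnergyClass`, its trivial downward
# extension, time shift of slab integrals, slab integrability

Route `AxisTwistDoor`, crux `AveragedConeLiouville` (stmt-NavierStokesRegularity-26889, CLOSED; the T1 programme
re-proves the typed INPUT `NazarovUraltseva2011_positivity_propagation (EuclideanSpace ℝ (Fin 3))` at Literature
pace), kit `pub/ns-inputs/kits/N4-T1-skeleton.lean` 118454bf17607d1e, stub W = `Sig.nu_standing_of_weak`, brick (c2)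
= the energy class of the frame pair (ns-in-ser-a g3; pub/ns-inputs STATUS 2026-08-28T14:24Z). This file holds the
parts of (c2) that do not mention the frame construction:

* `nuSlabIneq Φ U H Θ η u v` — the inequality of `NUEnergyClass` (`…NUDefs`, p629795) on ONE slab `[u,v]`
  (`nuEnergyClass_iff`: `NUEnergyClass` is `∀ H Θ η t₁ t₂ …, nuSlabIneq …` by `Iff.rfl`); `nuSlabIneq_self` (the
  degenerate slab); `nuSlabIneq_extend` — TRIVIAL EXTENSION DOWNWARDS: if `Φ(t,·) = 0` for `t ≤ a` and `U(t,·) = 0`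
  for `t < a`, the inequality on `[a,v]` gives the one on `[t₁,v]` (real bookkeeping: `M(t₁) = M(a) = H(0)∫Θ²`,
  dissipation and drift do not see `[t₁,a[`, `η(a) - η(t₁) ≤ ∫|η'|` by the FTC, the `|∇Θ|²` term is monotone;
  no `ofReal`-truncation issue because the added slab has zero dissipation);
* `measurePreserving_timeShift`, `setIntegral_slab_timeShift`, `setLIntegral_slab_timeShift` — the shift
  `(t,x) ↦ (t+τ,x)` on `ℝ × ℝ³` and `∫_{[a+τ,b+τ]×ℝ³} F = ∫_{[a,b]×ℝ³} F(·+τ,·)`;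
* `integrableOn_slab_of_bdd` — `f(t)·(g(t,x)·w(x))` (continuous · bounded measurable · continuous with compact
  support) is integrable on `[a,b] × ℝ³`; `volume_Icc_prod_univ_self`.

WHAT THIS IS NOT: not a statement about Navier–Stokes; T1 is an INPUT; the summit stays open.
[cite: NazarovUraltseva2011HarnackDivFree, §3 (arXiv:1011.1888 p. 8)]
-/

noncomputable section

-- the summit and its single sub-problem share the name (CONVENTIONS §1)
set_option linter.dupNamespace false

open MeasureTheory Set Function Filter Topology Metric
open scoped NNReal ENNReal

namespace Summit.NavierStokesRegularity.NavierStokesRegularity.Theorems.AveragedConeLiouville.NUPositivity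

section TimeShift

/-- The time shift `(t,x) ↦ (t+τ,x)` preserves the product volume on `ℝ × E`. -/
theorem measurePreserving_timeShift (τ : ℝ) :
    MeasurePreserving (fun z : ℝ × EuclideanSpace ℝ (Fin 3) => (z.1 + τ, z.2)) volume volume :=
  (measurePreserving_add_right volume τ).prod (MeasurePreserving.id (volume : Measure (EuclideanSpace ℝ (Fin 3))))

/-- The time shift is a measurable embedding (it is a measurable equivalence). -/
theorem measurableEmbedding_timeShift (τ : ℝ) :
    MeasurableEmbedding (fun z : ℝ × EuclideanSpace ℝ (Fin 3) => (z.1 + τ, z.2)) :=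
  ((MeasurableEquiv.addRight τ).prodCongr (MeasurableEquiv.refl (EuclideanSpace ℝ (Fin 3)))).measurableEmbedding

/-- Preimage of a shifted slab. -/
theorem preimage_timeShift_slab (τ a b : ℝ) :
    (fun z : ℝ × EuclideanSpace ℝ (Fin 3) => (z.1 + τ, z.2)) ⁻¹' (Icc (a + τ) (b + τ) ×ˢ
      (univ : Set (EuclideanSpace ℝ (Fin 3)))) = Icc a b ×ˢ univ := by
  ext z
  simp only [mem_preimage, mem_prod, mem_Icc, mem_univ, and_true, add_le_add_iff_right]

/-- **Time shift of a Bochner slab integral**: `∫_{[a+τ,b+τ]×E} F = ∫_{[a,b]×E} F(t+τ,x)`. -/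
theorem setIntegral_slab_timeShift {F' : Type*} [NormedAddCommGroup F'] [NormedSpace ℝ F']
    (F : ℝ × EuclideanSpace ℝ (Fin 3) → F') (τ a b : ℝ) :
    ∫ z in Icc (a + τ) (b + τ) ×ˢ (univ : Set (EuclideanSpace ℝ (Fin 3))), F z =
      ∫ z in Icc a b ×ˢ (univ : Set (EuclideanSpace ℝ (Fin 3))), F (z.1 + τ, z.2) := by
  rw [← preimage_timeShift_slab τ a b]
  exact ((measurePreserving_timeShift τ).setIntegral_preimage_emb (measurableEmbedding_timeShift τ) F _).symm

/-- **Time shift of a slab `lintegral`**: `∫⁻_{[a+τ,b+τ]×E} G = ∫⁻_{[a,b]×E} G(t+τ,x)`. -/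
theorem setLIntegral_slab_timeShift (G : ℝ × EuclideanSpace ℝ (Fin 3) → ℝ≥0∞) (τ a b : ℝ) :
    ∫⁻ z in Icc (a + τ) (b + τ) ×ˢ (univ : Set (EuclideanSpace ℝ (Fin 3))), G z =
      ∫⁻ z in Icc a b ×ˢ (univ : Set (EuclideanSpace ℝ (Fin 3))), G (z.1 + τ, z.2) := by
  rw [← preimage_timeShift_slab τ a b]
  exact ((measurePreserving_timeShift τ).setLIntegral_comp_preimage_emb (measurableEmbedding_timeShift τ)
    G _).symm

end TimeShift

section Slab

/-- The degenerate slab `[a,a] × E` is a null set. -/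
theorem volume_Icc_prod_univ_self (a : ℝ) :
    volume (Icc a a ×ˢ (univ : Set (EuclideanSpace ℝ (Fin 3)))) = 0 := by
  rw [Measure.volume_eq_prod, Measure.prod_prod, Real.volume_Icc, sub_self, ENNReal.ofReal_zero, zero_mul]

/-- **Slab integrability of a bounded product with compact `x`-support.** If `f : ℝ → ℝ` is continuous,
`g : ℝ × E → ℝ` is measurable with `|g| ≤ M`, and `w : E → ℝ` is continuous and vanishes off a compact set
`K`, then `z ↦ f z.1 * (g z * w z.2)` is integrable on `[a,b] × E`. -/
theorem integrableOn_slab_of_bdd {f : ℝ → ℝ} {g : ℝ × EuclideanSpace ℝ (Fin 3) → ℝ}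
    {w : EuclideanSpace ℝ (Fin 3) → ℝ} {K : Set (EuclideanSpace ℝ (Fin 3))} {a b M : ℝ}
    (hf : Continuous f) (hg : Measurable g) (hgb : ∀ z, |g z| ≤ M) (hw : Continuous w)
    (hK : IsCompact K) (hwK : ∀ x, x ∉ K → w x = 0) :
    IntegrableOn (fun z : ℝ × EuclideanSpace ℝ (Fin 3) => f z.1 * (g z * w z.2))
      (Icc a b ×ˢ (univ : Set (EuclideanSpace ℝ (Fin 3)))) volume := by
  -- bounds for the continuous factors on the compact sets
  obtain ⟨Cf, hCf⟩ : ∃ C, ∀ t ∈ Icc a b, ‖f t‖ ≤ C :=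
    isCompact_Icc.exists_bound_of_continuousOn hf.continuousOn
  obtain ⟨Cw, hCw⟩ : ∃ C, ∀ x ∈ K, ‖w x‖ ≤ C := hK.exists_bound_of_continuousOn hw.continuousOn
  have hCw' : ∀ x, ‖w x‖ ≤ max Cw 0 := fun x => by
    by_cases hx : x ∈ K
    · exact (hCw x hx).trans (le_max_left _ _)
    · rw [hwK x hx, norm_zero]; exact le_max_right _ _
  have hmeas : AEStronglyMeasurable (fun z : ℝ × EuclideanSpace ℝ (Fin 3) => f z.1 * (g z * w z.2)) volume :=
    ((hf.measurable.comp measurable_fst).mul (hg.mul (hw.measurable.comp measurable_snd))).aestronglyMeasurable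
  -- integrable on the compact box `[a,b] × K`
  have hbox : IntegrableOn (fun z : ℝ × EuclideanSpace ℝ (Fin 3) => f z.1 * (g z * w z.2))
      (Icc a b ×ˢ K) volume := by
    refine Measure.integrableOn_of_bounded (M := Cf * (M * max Cw 0)) ?_ hmeas ?_
    · rw [Measure.volume_eq_prod, Measure.prod_prod]
      exact ENNReal.mul_ne_top measure_Icc_lt_top.ne hK.measure_lt_top.ne
    · rw [ae_restrict_iff' (measurableSet_Icc.prod hK.measurableSet)]
      refine Eventually.of_forall fun z hz => ?_
      rw [norm_mul, norm_mul]
      have h1 : ‖f z.1‖ ≤ Cf := hCf z.1 hz.1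
      have h2 : ‖g z‖ ≤ M := by rw [Real.norm_eq_abs]; exact hgb z
      have h3 : ‖w z.2‖ ≤ max Cw 0 := hCw' z.2
      have hM : 0 ≤ M := (abs_nonneg _).trans (hgb z)
      have hCf0 : 0 ≤ Cf := (norm_nonneg _).trans h1
      exact mul_le_mul h1 (mul_le_mul h2 h3 (norm_nonneg _) hM) (by positivity) hCf0
  -- zero off the box
  refine IntegrableOn.of_forall_sdiff_eq_zero hbox (measurableSet_Icc.prod MeasurableSet.univ) fun z hz => ?_
  have hz2 : z.2 ∉ K := fun h => hz.2 ⟨hz.1.1, h⟩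
  simp only [hwK z.2 hz2, mul_zero]

end Slab


/-- **The `NUEnergyClass` inequality of a pair `(Φ, U)` for `H, Θ, η` on ONE slab `[u,v]`** — literally the body of
`NUEnergyClass` (`…NUDefs`, p629795) with `t₁ t₂ ↦ u v`. -/
def nuSlabIneq (Φ : ℝ → EuclideanSpace ℝ (Fin 3) → ℝ) (U : ℝ → EuclideanSpace ℝ (Fin 3) → EuclideanSpace ℝ (Fin 3))
    (H : ℝ → ℝ) (Θ : EuclideanSpace ℝ (Fin 3) → ℝ) (η : ℝ → ℝ) (u v : ℝ) : Prop :=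
  ENNReal.ofReal (η v * ∫ x, H (Φ v x) * Θ x ^ 2) +
      ∫⁻ z in Icc u v ×ˢ (univ : Set (EuclideanSpace ℝ (Fin 3))), ENNReal.ofReal
        (1 / 2 * η z.1 * (deriv (deriv H) (Φ z.1 z.2) * ‖gradient (Φ z.1) z.2‖ ^ 2 * Θ z.2 ^ 2))
    ≤ ENNReal.ofReal (η u * (∫ x, H (Φ u x) * Θ x ^ 2) +
        (4 * ∫ z in Icc u v ×ˢ (univ : Set (EuclideanSpace ℝ (Fin 3))),
          η z.1 * (H (Φ z.1 z.2) * ‖gradient Θ z.2‖ ^ 2)) +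
        (∫ z in Icc u v ×ˢ (univ : Set (EuclideanSpace ℝ (Fin 3))),
          η z.1 * (H (Φ z.1 z.2) * inner ℝ (U z.1 z.2) (gradient (fun y => Θ y ^ 2) z.2))) +
        (∫ z in Icc u v ×ˢ (univ : Set (EuclideanSpace ℝ (Fin 3))),
          |deriv η z.1| * (H (Φ z.1 z.2) * Θ z.2 ^ 2)))

/-- `NUEnergyClass` is the slab inequality for all admissible `H, Θ, η` and all slabs of the frame window. -/
theorem nuEnergyClass_iff (Φ : ℝ → EuclideanSpace ℝ (Fin 3) → ℝ)
    (U : ℝ → EuclideanSpace ℝ (Fin 3) → EuclideanSpace ℝ (Fin 3)) (k R : ℝ) :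
    NUEnergyClass Φ U k R ↔
    ∀ (H : ℝ → ℝ), ContDiff ℝ 2 H → (∀ v, deriv H v ≤ 0) → (∀ v, 0 ≤ H v) →
      (∀ v, 0 ≤ deriv (deriv H) v) → (∀ v, deriv H v ^ 2 ≤ 2 * H v * deriv (deriv H) v) →
      (∀ v, k ≤ v → H v = 0) →
    ∀ (Θ : EuclideanSpace ℝ (Fin 3) → ℝ), ContDiff ℝ 1 Θ → HasCompactSupport Θ →
      tsupport Θ ⊆ ball (0 : EuclideanSpace ℝ (Fin 3)) (2 * R) →
    ∀ (η : ℝ → ℝ), ContDiff ℝ 1 η → (∀ s, 0 ≤ η s) →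
    ∀ (t₁ t₂ : ℝ), -R ^ 2 < t₁ → t₁ ≤ t₂ → t₂ < 0 → nuSlabIneq Φ U H Θ η t₁ t₂ :=
  Iff.rfl

/-! ### Generic facts about the slab inequality -/

/-- The degenerate slab `[v,v]` (a null set): the inequality is an equality of the two `M`-terms. -/
theorem nuSlabIneq_self (Φ : ℝ → EuclideanSpace ℝ (Fin 3) → ℝ)
    (U : ℝ → EuclideanSpace ℝ (Fin 3) → EuclideanSpace ℝ (Fin 3)) (H : ℝ → ℝ)
    (Θ : EuclideanSpace ℝ (Fin 3) → ℝ) (η : ℝ → ℝ) (v : ℝ) : nuSlabIneq Φ U H Θ η v v := by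
  unfold nuSlabIneq
  have h0 : (volume : Measure (ℝ × EuclideanSpace ℝ (Fin 3))).restrict
      (Icc v v ×ˢ (univ : Set (EuclideanSpace ℝ (Fin 3)))) = 0 :=
    Measure.restrict_eq_zero.2 (volume_Icc_prod_univ_self v)
  simp only [h0, lintegral_zero_measure, integral_zero_measure, add_zero, mul_zero, le_refl]

/-- **Trivial extension downwards.** If `Φ(t,·) = 0` for `t ≤ a` and `U(t,·) = 0` for `t < a`, the `|∇Θ|²`- and
`|η'|`-integrands are integrable on `[t₁,v] × ℝ³`, `H ≥ 0`, `η ≥ 0` is `C¹`, and the slab inequality holds on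
`[a,v]`, then it holds on `[t₁,v]` (`t₁ ≤ a ≤ v`). -/
theorem nuSlabIneq_extend {Φ : ℝ → EuclideanSpace ℝ (Fin 3) → ℝ}
    {U : ℝ → EuclideanSpace ℝ (Fin 3) → EuclideanSpace ℝ (Fin 3)} {H : ℝ → ℝ}
    {Θ : EuclideanSpace ℝ (Fin 3) → ℝ} {η : ℝ → ℝ} {t₁ a v : ℝ} (ht₁a : t₁ ≤ a) (hav : a ≤ v)
    (hH0 : ∀ w, 0 ≤ H w) (hη1 : ContDiff ℝ 1 η) (hη0 : ∀ s, 0 ≤ η s)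
    (hΦ0 : ∀ t, t ≤ a → ∀ x, Φ t x = 0) (hU0 : ∀ t, t < a → ∀ x, U t x = 0)
    (hA : IntegrableOn (fun z : ℝ × EuclideanSpace ℝ (Fin 3) => η z.1 * (H (Φ z.1 z.2) * ‖gradient Θ z.2‖ ^ 2))
      (Icc t₁ v ×ˢ (univ : Set (EuclideanSpace ℝ (Fin 3)))) volume)
    (hC : IntegrableOn (fun z : ℝ × EuclideanSpace ℝ (Fin 3) => |deriv η z.1| * (H (Φ z.1 z.2) * Θ z.2 ^ 2))
      (Icc t₁ v ×ˢ (univ : Set (EuclideanSpace ℝ (Fin 3)))) volume)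
    (h : nuSlabIneq Φ U H Θ η a v) : nuSlabIneq Φ U H Θ η t₁ v := by
  unfold nuSlabIneq at h ⊢
  -- names
  set S : ℝ → Set (ℝ × EuclideanSpace ℝ (Fin 3)) := fun u => Icc u v ×ˢ (univ : Set (EuclideanSpace ℝ (Fin 3)))
    with hS
  set fA : ℝ × EuclideanSpace ℝ (Fin 3) → ℝ := fun z => η z.1 * (H (Φ z.1 z.2) * ‖gradient Θ z.2‖ ^ 2) with hfA
  set fB : ℝ × EuclideanSpace ℝ (Fin 3) → ℝ := fun z =>
    η z.1 * (H (Φ z.1 z.2) * inner ℝ (U z.1 z.2) (gradient (fun y => Θ y ^ 2) z.2)) with hfB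
  set fC : ℝ × EuclideanSpace ℝ (Fin 3) → ℝ := fun z => |deriv η z.1| * (H (Φ z.1 z.2) * Θ z.2 ^ 2) with hfC
  set gD : ℝ × EuclideanSpace ℝ (Fin 3) → ℝ≥0∞ := fun z => ENNReal.ofReal
    (1 / 2 * η z.1 * (deriv (deriv H) (Φ z.1 z.2) * ‖gradient (Φ z.1) z.2‖ ^ 2 * Θ z.2 ^ 2)) with hgD
  have hSm : ∀ u, MeasurableSet (S u) := fun u => measurableSet_Icc.prod MeasurableSet.univ
  have hsub : S a ⊆ S t₁ := Set.prod_mono (Icc_subset_Icc ht₁a le_rfl) le_rfl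
  have hmem_low : ∀ z, z ∈ S t₁ \ S a → z.1 < a := by
    intro z hz
    by_contra hza
    exact hz.2 ⟨⟨not_lt.1 hza, hz.1.1.2⟩, mem_univ _⟩
  -- the `M`-terms at `t₁` and `a`
  set m₀ : ℝ := ∫ x, H 0 * Θ x ^ 2 with hm₀
  have hm₀0 : 0 ≤ m₀ := integral_nonneg fun x => mul_nonneg (hH0 0) (sq_nonneg _)
  have hMt₁ : ∫ x, H (Φ t₁ x) * Θ x ^ 2 = m₀ := by
    rw [hm₀]; congr 1; funext x; rw [hΦ0 t₁ ht₁a x]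
  have hMa : ∫ x, H (Φ a x) * Θ x ^ 2 = m₀ := by
    rw [hm₀]; congr 1; funext x; rw [hΦ0 a le_rfl x]
  -- (i) the dissipation does not see `[t₁, a[`
  have hD : ∫⁻ z in S t₁, gD z = ∫⁻ z in S a, gD z := by
    have hsplit : S t₁ = (Ico t₁ a ×ˢ (univ : Set (EuclideanSpace ℝ (Fin 3)))) ∪ S a := by
      simp only [hS, ← union_prod, Ico_union_Icc_eq_Icc ht₁a hav]
    have hdisj : Disjoint (Ico t₁ a ×ˢ (univ : Set (EuclideanSpace ℝ (Fin 3)))) (S a) :=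
      Set.disjoint_left.2 fun z hz hz' => (not_le.2 hz.1.2) hz'.1.1
    have hzero : ∫⁻ z in Ico t₁ a ×ˢ (univ : Set (EuclideanSpace ℝ (Fin 3))), gD z = 0 := by
      rw [setLIntegral_congr_fun (measurableSet_Ico.prod MeasurableSet.univ)
        (fun z hz => show gD z = 0 from ?_)]
      · exact lintegral_zero
      · have hΦz : Φ z.1 = fun _ => 0 := funext fun x => hΦ0 z.1 (le_of_lt hz.1.2) x
        have hg : gradient (Φ z.1) z.2 = 0 := by
          rw [hΦz]; unfold gradient; rw [fderiv_const_apply]; simp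
        simp only [hgD, hg, norm_zero]
        norm_num
    rw [hsplit, lintegral_union (hSm a) hdisj, hzero, zero_add]
  -- (ii) the drift term does not see `[t₁, a[`
  have hB : ∫ z in S t₁, fB z = ∫ z in S a, fB z := by
    refine setIntegral_eq_of_subset_of_forall_sdiff_eq_zero (hSm t₁) hsub fun z hz => ?_
    simp only [hfB, hU0 z.1 (hmem_low z hz) z.2, inner_zero_left, mul_zero]
  -- (iii) the `|∇Θ|²` term is monotone in the slab
  have hAmono : ∫ z in S a, fA z ≤ ∫ z in S t₁, fA z := by
    refine setIntegral_mono_set hA ?_ (Eventually.of_forall hsub)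
    exact Eventually.of_forall fun z => mul_nonneg (hη0 _) (mul_nonneg (hH0 _) (sq_nonneg _))
  -- (iv) the `|η'|` term on `[t₁, a[` controls `(η a - η t₁) m₀`
  have hCsplit : ∫ z in S t₁, fC z =
      (∫ z in Ico t₁ a ×ˢ (univ : Set (EuclideanSpace ℝ (Fin 3))), fC z) + ∫ z in S a, fC z := by
    have hsplit : S t₁ = (Ico t₁ a ×ˢ (univ : Set (EuclideanSpace ℝ (Fin 3)))) ∪ S a := by
      simp only [hS, ← union_prod, Ico_union_Icc_eq_Icc ht₁a hav]
    have hdisj : Disjoint (Ico t₁ a ×ˢ (univ : Set (EuclideanSpace ℝ (Fin 3)))) (S a) :=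
      Set.disjoint_left.2 fun z hz hz' => (not_le.2 hz.1.2) hz'.1.1
    have hsubI : Ico t₁ a ×ˢ (univ : Set (EuclideanSpace ℝ (Fin 3))) ⊆ S t₁ :=
      Set.prod_mono (Ico_subset_Icc_self.trans (Icc_subset_Icc le_rfl hav)) le_rfl
    rw [hsplit, setIntegral_union hdisj (hSm a) (hC.mono_set hsubI) (hC.mono_set hsub)]
  have hClow : (η a - η t₁) * m₀ ≤ ∫ z in Ico t₁ a ×ˢ (univ : Set (EuclideanSpace ℝ (Fin 3))), fC z := by
    have hcongr : ∫ z in Ico t₁ a ×ˢ (univ : Set (EuclideanSpace ℝ (Fin 3))), fC z =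
        ∫ z in Ico t₁ a ×ˢ (univ : Set (EuclideanSpace ℝ (Fin 3))), |deriv η z.1| * (H 0 * Θ z.2 ^ 2) := by
      refine setIntegral_congr_fun (measurableSet_Ico.prod MeasurableSet.univ) fun z hz => ?_
      simp only [hfC, hΦ0 z.1 (le_of_lt hz.1.2) z.2]
    have hprod : ∫ z in Ico t₁ a ×ˢ (univ : Set (EuclideanSpace ℝ (Fin 3))), |deriv η z.1| * (H 0 * Θ z.2 ^ 2) =
        (∫ s in Ico t₁ a, |deriv η s|) * m₀ := by
      have hpm := setIntegral_prod_mul (μ := (volume : Measure ℝ))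
        (ν := (volume : Measure (EuclideanSpace ℝ (Fin 3)))) (fun s => |deriv η s|) (fun x => H 0 * Θ x ^ 2)
        (Ico t₁ a) univ
      rw [Measure.restrict_univ] at hpm
      rw [hm₀, Measure.volume_eq_prod]
      exact hpm
    rw [hcongr, hprod]
    refine mul_le_mul_of_nonneg_right ?_ hm₀0
    -- `η a - η t₁ = ∫_{t₁}^{a} η' ≤ ∫_{t₁}^{a} |η'|`
    have hηd : ∀ x, DifferentiableAt ℝ η x := fun x => (hη1.differentiable one_ne_zero) x
    have hηc : Continuous (deriv η) := hη1.continuous_deriv le_rfl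
    have hFTC : ∫ s in t₁..a, deriv η s = η a - η t₁ :=
      intervalIntegral.integral_deriv_eq_sub (fun x _ => hηd x) (hηc.intervalIntegrable _ _)
    have hle : ∫ s in t₁..a, deriv η s ≤ ∫ s in t₁..a, |deriv η s| :=
      intervalIntegral.integral_mono_on ht₁a (hηc.intervalIntegrable _ _) (hηc.abs.intervalIntegrable _ _)
        fun s _ => le_abs_self _
    rw [integral_Ico_eq_integral_Ioo, ← integral_Ioc_eq_integral_Ioo, ← intervalIntegral.integral_of_le ht₁a,
      ← hFTC]
    exact hle
  -- (v) combine
  have hreal : η a * (∫ x, H (Φ a x) * Θ x ^ 2) + (4 * ∫ z in S a, fA z) + (∫ z in S a, fB z) + (∫ z in S a, fC z)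
      ≤ η t₁ * (∫ x, H (Φ t₁ x) * Θ x ^ 2) + (4 * ∫ z in S t₁, fA z) + (∫ z in S t₁, fB z) +
        (∫ z in S t₁, fC z) := by
    rw [hMa, hMt₁, hB, hCsplit]
    nlinarith [hAmono, hClow, hm₀0]
  calc ENNReal.ofReal (η v * ∫ x, H (Φ v x) * Θ x ^ 2) + ∫⁻ z in S t₁, gD z
      = ENNReal.ofReal (η v * ∫ x, H (Φ v x) * Θ x ^ 2) + ∫⁻ z in S a, gD z := by rw [hD]
    _ ≤ _ := h
    _ ≤ _ := ENNReal.ofReal_le_ofReal hreal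

end Summit.NavierStokesRegularity.NavierStokesRegularity.Theorems.AveragedConeLiouville.NUPositivity

end
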